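import Summits.CriticalPhenomena.SAWScalingLimit.Theorems.SAWDefectDecoherenceMassRatioFlatRootDefs

/-!
# Objects of the line `mirror-doubling-endpoint-restriction` for the crux `SAWDefectDecoherence.MassRatio`
(stmt-CriticalPhenomena-8550; lead prover, crux protocol; skeleton
`Summits/CriticalPhenomena/SAWScalingLimit/Cruxes/MassRatio/Lines/mirror_doubling_endpoint_restriction.lean`)

The rows clause of the crux frame makes `Λ_δ ∩ B(b,ρ)` an exact half-lattice, so the lattice ball of
radius `R = ⌊ρ'/δ⌋` about `mid b_δ` glues in below the door line — the DOUBLING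
`double (Λ δ) (b δ) R = Λ_δ ∪ Ball(mid b_δ, R)` — turning `b_δ` into a deep bulk mid-edge while
cutting no walk. The line reads `MassRatio(s + t) ⟸ InteriorHarnack(s) ∧ EndpointRestriction(t)` and
derives the endpoint restriction from its CANONICAL instance (the exact half-lattice half-disc `H_R` of
radius `4R` doubled by the lattice ball of radius `R` under its central door edge `c₀`, root door edge
`a_R` at distance `2R`) plus one exponent-`0` ratio-mixing statement.

This file only DEFINES the objects the line's registered stubs and glue speak about (no statement of
the line is asserted), reusing the crux frame `FlatRoot.Frame`, the cut predicate
`FlatRoot.MassRatioAt` and the mass `Renewal.Z` already in the tree: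

* `ball`, `double`, `scaleR`, `rhoCap` (the radius cap `min(ρ, |pt 0 − pt 1|)/8`), the canonical
  family `cEdge`, `aEdge`, `canonDisc R`;
* the predicates `InteriorHarnack s`, `EndpointRestriction t`, `CanonicalRestriction t`,
  `RatioMixing D ρ Λ m a b` (per datum);
* lattice lemmas: finiteness of scaled lattice balls, `subset_double`, `rhoCap_pos/_le/_le_dist`,
  positivity of the canonical boundary-to-boundary mass `canonical_pos` (the registered trivial
  sub-goal of this file), `aEdge_mem_boundary`, `cEdge_mem_boundary`, `cEdge_subset_double`
  (non-vacuity of the canonical family).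

Sources: the line card `Cruxes/MassRatio/Lines/mirror-doubling-endpoint-restriction.md`; the idea
card `Cruxes/MassRatio/Ideas/mirror-doubling-endpoint-restriction.md` (ideator 5, round 2);
G. Lawler, O. Schramm, W. Werner, *On the scaling limit of planar self-avoiding walk* (2004) §3.4
(restriction exponents, predictions only); H. Duminil-Copin, S. Smirnov, Ann. of Math. 175 (2012).
Deliberately NOT here: the three stub statements as theorems and the glue (`…MirrorGlue.lean`).
-/

noncomputable section

namespace Summit.CriticalPhenomena.SAWScalingLimit.Theorems.MassRatio.Mirror

open Literature.Probability.LatticeModels Literature.Probability.RandomPlanarGeometry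
open Literature.Probability.RandomPlanarGeometry.SAW
open Summit.CriticalPhenomena.SAWScalingLimit.Theorems.MassRatio.Negative
open Summit.CriticalPhenomena.SAWScalingLimit.Theorems.MassRatio.Renewal (Z)
open Summit.CriticalPhenomena.SAWScalingLimit.Theorems.MassRatio.FlatRoot (Frame MassRatioAt massK)
open scoped Classical

/-! ### Lattice balls and the doubling -/

/-- For `δ > 0` only finitely many honeycomb vertices have their scaled centre in a given ball
(brick coordinates are bounded there). -/
theorem finite_scaled_ball (δ : ℝ) (hδ : 0 < δ) (z : ℂ) (R : ℝ) :
    {v : HexVertex | (δ : ℂ) * hexCenter v ∈ Metric.ball z R}.Finite := by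
  set M : ℝ := ‖z‖ + |R| with hM
  have hM0 : 0 ≤ M := by positivity
  have hh := hgt_pos
  obtain ⟨N, hN⟩ : ∃ N : ℕ, 2 * M / δ + M / (δ * hgt) + 2 ≤ N := exists_nat_ge _
  have hN1 : 2 * M / δ + 1 ≤ N := by
    have : 0 ≤ M / (δ * hgt) := by positivity
    linarith
  have hN2 : M / (δ * hgt) + 1 ≤ N := by
    have : 0 ≤ 2 * M / δ := by positivity
    linarith
  refine Set.Finite.subset (((Finset.Icc (-(N : ℤ)) N) ×ˢ (Finset.Icc (-(N : ℤ)) N)).image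
    (fun rp : ℤ × ℤ => bv rp.1 rp.2)).finite_toSet ?_
  intro v hv
  simp only [Set.mem_setOf_eq, Metric.mem_ball] at hv
  have hnorm : ‖(δ : ℂ) * hexCenter v‖ < M := by
    have h1 : ‖(δ : ℂ) * hexCenter v‖ ≤ ‖(δ : ℂ) * hexCenter v - z‖ + ‖z‖ := by
      have := norm_add_le ((δ : ℂ) * hexCenter v - z) z
      simpa using this
    have h2 : ‖(δ : ℂ) * hexCenter v - z‖ < R := by rwa [← dist_eq_norm]
    have h3 : R ≤ |R| := le_abs_self R
    linarith
  have hre : |((δ : ℂ) * hexCenter v).re| < M :=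
    lt_of_le_of_lt (Complex.abs_re_le_norm _) hnorm
  have him : |((δ : ℂ) * hexCenter v).im| < M :=
    lt_of_le_of_lt (Complex.abs_im_le_norm _) hnorm
  rw [re_scaled] at hre
  have him1 := im_scaled_ge δ hδ.le v
  have him2 := im_scaled_le δ hδ.le v
  rw [abs_lt] at hre him
  have hp1 : ((pos v : ℝ)) ≤ N := by
    have : δ * ((pos v : ℝ) + 1) < 2 * M := by linarith [hre.2]
    have : (pos v : ℝ) + 1 < 2 * M / δ := by
      rw [lt_div_iff₀ hδ]; linarith
    linarith
  have hp2 : (-(N : ℝ)) ≤ (pos v : ℝ) := by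
    have : -(2 * M) < δ * ((pos v : ℝ) + 1) := by linarith [hre.1]
    have : -(2 * M / δ) < (pos v : ℝ) + 1 := by
      rw [neg_lt, lt_div_iff₀ hδ]; linarith
    linarith
  have hδh : 0 < δ * hgt := mul_pos hδ hh
  have hr1 : ((row v : ℝ)) ≤ N := by
    have : δ * hgt * ((row v : ℝ) + 1 / 3) < M := by linarith [him.2]
    have : (row v : ℝ) + 1 / 3 < M / (δ * hgt) := by
      rw [lt_div_iff₀ hδh]; linarith
    linarith
  have hr2 : (-(N : ℝ)) ≤ (row v : ℝ) := by
    have : -M < δ * hgt * ((row v : ℝ) + 2 / 3) := by linarith [him.1]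
    have : -(M / (δ * hgt)) < (row v : ℝ) + 2 / 3 := by
      rw [neg_lt, lt_div_iff₀ hδh]; linarith
    linarith
  simp only [Finset.coe_image, Finset.coe_product, Finset.coe_Icc, Set.mem_image, Set.mem_prod,
    Set.mem_Icc, Prod.exists]
  refine ⟨row v, pos v, ⟨⟨?_, ?_⟩, ?_, ?_⟩, bv_row_pos v⟩
  · exact_mod_cast hr2
  · exact_mod_cast hr1
  · exact_mod_cast hp2
  · exact_mod_cast hp1

/-- A lattice ball (vertices whose centre lies in `B(z, r)`) is a finite set. -/
theorem finite_ball (z : ℂ) (r : ℝ) : {v : HexVertex | hexCenter v ∈ Metric.ball z r}.Finite := by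
  simpa using finite_scaled_ball 1 one_pos z r

/-- The lattice ball `{v : c_v ∈ B(z, r)}` as a `Finset` (unscaled lattice coordinates). [folklore] -/
def ball (z : ℂ) (r : ℝ) : Finset HexVertex := (finite_ball z r).toFinset

/-- Membership in the lattice ball. -/
@[simp] theorem mem_ball {z : ℂ} {r : ℝ} {v : HexVertex} :
    v ∈ ball z r ↔ dist (hexCenter v) z < r := by
  simp [ball, Set.Finite.mem_toFinset]

/-- THE DOUBLING: `Λ` together with the lattice ball of radius `R` (lattice units) about the midpoint
of the mid-edge `b`. In the frame, with `R = ⌊ρ'/δ⌋` and `ρ' ≤ rhoCap`, the ball's upper half is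
already in `Λ_δ` (rows clause) and the added vertices are the phantom lower half-ball hanging from
the door line under `b_δ` (`b_δ` becomes a bulk mid-edge at depth `≍ ρ'`). [folklore] -/
def double (Λ : Finset HexVertex) (b : Sym2 HexVertex) (R : ℝ) : Finset HexVertex :=
  Λ ∪ ball (hexMidpoint b) R

/-- `Λ ⊆ Λ⁺`. -/
theorem subset_double (Λ : Finset HexVertex) (b : Sym2 HexVertex) (R : ℝ) : Λ ⊆ double Λ b R :=
  Finset.subset_union_left

/-- The lattice radius of the phantom ball at mesh `δ`: `R = ⌊ρ'/δ⌋`. [folklore] -/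
def scaleR (ρ' δ : ℝ) : ℕ := ⌊ρ' / δ⌋₊

/-- The radius cap of the line (triage r2 S1): `min(ρ, dist(pt 0, pt 1)) / 8`. Every construction at
`b` lives in `B(b, 4ρ')`, `ρ' ≤ rhoCap`, hence inside the flat piece AND at distance
`≥ dist(pt 0, pt 1)/2` from the root. [folklore] -/
def rhoCap (D : DobrushinDomain) (ρ : ℝ) : ℝ := min ρ (dist (D.pt 0) (D.pt 1)) / 8

/-- `0 < rhoCap` in the frame (`ρ > 0`, `pt 0 ≠ pt 1`). -/
theorem rhoCap_pos (D : DobrushinDomain) {ρ : ℝ} (hρ : 0 < ρ) : 0 < rhoCap D ρ := by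
  have h01 : D.pt 0 ≠ D.pt 1 := fun h => absurd (D.pt_injective h) (by decide)
  have hd : 0 < dist (D.pt 0) (D.pt 1) := dist_pos.2 h01
  unfold rhoCap
  exact div_pos (lt_min hρ hd) (by norm_num)

/-- `8 · rhoCap ≤ ρ`. -/
theorem rhoCap_le (D : DobrushinDomain) (ρ : ℝ) : 8 * rhoCap D ρ ≤ ρ := by
  unfold rhoCap; linarith [min_le_left ρ (dist (D.pt 0) (D.pt 1))]

/-- `8 · rhoCap ≤ dist(pt 0, pt 1)`. -/
theorem rhoCap_le_dist (D : DobrushinDomain) (ρ : ℝ) : 8 * rhoCap D ρ ≤ dist (D.pt 0) (D.pt 1) := by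
  unfold rhoCap; linarith [min_le_right ρ (dist (D.pt 0) (D.pt 1))]

/-! ### The canonical one-parameter family -/

/-- The canonical door edge `c₀ = {(row 0, pos 0), (row −1, pos 0)}` (midpoint `1/2 + 0·i`). [folklore] -/
def cEdge : Sym2 HexVertex := s(bv 0 0, bv (-1) 0)

/-- The canonical root: the door edge of row `0` at position `4R` (outer vertex first). [folklore] -/
def aEdge (R : ℕ) : Sym2 HexVertex := s(bv (-1) (4 * R), bv 0 (4 * R))

/-- The canonical domain `H_R`: the exact upper half-lattice (`row ≥ 0`) inside the lattice disc of
radius `4R` about `mid c₀` — a half-disc with flat bottom; `c₀` and `a_R` are door edges of it, and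
its doubling `double (canonDisc R) cEdge R` hangs the lattice ball of radius `R` under `c₀`. [folklore] -/
def canonDisc (R : ℕ) : Finset HexVertex :=
  (ball (hexMidpoint cEdge) (4 * R)).filter (fun v => 0 ≤ row v)

/-! ### The statements of the line as predicates -/

/-- INTERIOR HARNACK at exponent `s` (infimum form): in the doubled domain the (now bulk) mid-edge
`b_δ` is no cold spot of the rooted two-point function — the averaged bulk mass over a compact
`K ⊂ Ω` is at most `C δ^{-s}` times the mass at `b_δ`. Predicted exponent `0`. [folklore] -/
def InteriorHarnack (s : ℝ) : Prop :=
  ∀ (D : DobrushinDomain) (ρ : ℝ) (Λ : ℝ → Finset HexVertex) (m : ℝ → ℤ)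
    (a b : ℝ → Sym2 HexVertex), Frame D ρ Λ m a b →
    ∀ ρ' : ℝ, 0 < ρ' → ρ' ≤ rhoCap D ρ →
      ∀ K : Set ℂ, IsCompact K → K ⊆ D.carrier → ∃ C : ℝ, ∀ᶠ δ : ℝ in nhdsWithin 0 (Set.Ioi 0),
        δ ^ 2 * (∑ᶠ e ∈ {e : Sym2 HexVertex | e ∈ hexDomainMidEdges (Λ δ) ∧
            (δ : ℂ) * hexMidpoint e ∈ K}, Z (double (Λ δ) (b δ) (scaleR ρ' δ)) (a δ) e)
          ≤ C * δ ^ (-s) * Z (double (Λ δ) (b δ) (scaleR ρ' δ)) (a δ) (b δ)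

/-- ONE-SIDED RESTRICTION AT THE ENDPOINT (exponent `t`): the walks from the far root `a_δ` to the
deep bulk mid-edge `b_δ` of the doubled domain that avoid the phantom half-ball — i.e. stay in
`Λ_δ` — carry at least a `c δ^t` fraction of the mass. Predicted `t = h_b − x₁ = 25/48`. [folklore] -/
def EndpointRestriction (t : ℝ) : Prop :=
  ∀ (D : DobrushinDomain) (ρ : ℝ) (Λ : ℝ → Finset HexVertex) (m : ℝ → ℤ)
    (a b : ℝ → Sym2 HexVertex), Frame D ρ Λ m a b →
    ∀ ρ' : ℝ, 0 < ρ' → ρ' ≤ rhoCap D ρ →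
      ∃ c : ℝ, 0 < c ∧ ∀ᶠ δ : ℝ in nhdsWithin 0 (Set.Ioi 0),
        c * δ ^ t * Z (double (Λ δ) (b δ) (scaleR ρ' δ)) (a δ) (b δ) ≤ Z (Λ δ) (a δ) (b δ)

/-- CANONICAL RESTRICTION (exponent `t`): in the explicit family `H_R = canonDisc R`, the
boundary-to-boundary mass `Z_{H_R}(a_R → c₀)` is at least `c₀ R^{-t}` times the boundary-to-bulk
mass `Z_{H_R ∪ Ball_R}(a_R → c₀)` of the doubled half-disc, for every `R ≥ 1`. Predicted
`R^{-25/48}`; the simple-random-walk value is `R^{-1}`. [folklore] -/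
def CanonicalRestriction (t : ℝ) : Prop :=
  ∃ c₀ : ℝ, 0 < c₀ ∧ ∀ R : ℕ, 1 ≤ R →
    c₀ * (R : ℝ) ^ (-t) * Z (double (canonDisc R) cEdge R) (aEdge R) cEdge
      ≤ Z (canonDisc R) (aEdge R) cEdge

/-- RATIO MIXING for one datum (exponent `0`): in the frame, at scale `R = ⌊ρ'/δ⌋`, the avoidance
ratio `Z_Λ(a→b_δ)/Z_{Λ⁺}(a→b_δ)` is at least a constant times the canonical avoidance ratio
`Z_{H_R}(a_R→c₀)/Z_{H_R ∪ Ball_R}(a_R→c₀)` — written multiplied out (four partition functions,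
nothing decomposed). [folklore] -/
def RatioMixing (D : DobrushinDomain) (ρ : ℝ) (Λ : ℝ → Finset HexVertex) (m : ℝ → ℤ)
    (a b : ℝ → Sym2 HexVertex) : Prop :=
  Frame D ρ Λ m a b →
    ∀ ρ' : ℝ, 0 < ρ' → ρ' ≤ rhoCap D ρ →
      ∃ c : ℝ, 0 < c ∧ ∀ᶠ δ : ℝ in nhdsWithin 0 (Set.Ioi 0),
        c * (Z (double (Λ δ) (b δ) (scaleR ρ' δ)) (a δ) (b δ) *
              Z (canonDisc (scaleR ρ' δ)) (aEdge (scaleR ρ' δ)) cEdge)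
          ≤ Z (Λ δ) (a δ) (b δ) *
              Z (double (canonDisc (scaleR ρ' δ)) cEdge (scaleR ρ' δ)) (aEdge (scaleR ρ' δ)) cEdge

/-! ### The canonical masses are positive; the canonical family is non-vacuous -/

/-- Real part of `mid c₀`. -/
theorem cMid_re : (hexMidpoint cEdge).re = 1 / 2 := by
  rw [cEdge, mid_re, pos_bv, pos_bv]; norm_num

/-- Imaginary part of `mid c₀`. -/
theorem cMid_im : (hexMidpoint cEdge).im = 0 := by
  rw [cEdge, mid_im, im_center_bv_even (r := 0) (p := 0) (by norm_num),
    im_center_bv_odd (r := -1) (p := 0) (by norm_num)]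
  push_cast; ring

/-- Row-`0` vertices at positions `0 … 4R` lie in the canonical half-disc. -/
theorem bv_zero_mem_canonDisc {R : ℕ} (hR : 1 ≤ R) {p : ℤ} (hp0 : 0 ≤ p) (hp : p ≤ 4 * R) :
    bv 0 p ∈ canonDisc R := by
  rw [canonDisc, Finset.mem_filter, mem_ball, row_bv]
  refine ⟨?_, le_rfl⟩
  rw [Complex.dist_eq]
  have hre : ((hexCenter (bv 0 p) - hexMidpoint cEdge).re : ℝ) = p / 2 := by
    rw [Complex.sub_re, re_center_bv, cMid_re]; ring
  have hlt := hgt_lt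
  have hgt0 := hgt_pos
  have him : |(hexCenter (bv 0 p) - hexMidpoint cEdge).im| ≤ 1 := by
    rw [Complex.sub_im, cMid_im, sub_zero]
    rcases Int.emod_two_eq_zero_or_one (p - 0) with h | h
    · rw [im_center_bv_even h]
      have h0 : (0 : ℝ) ≤ hgt * (((0 : ℤ) : ℝ) + 1 / 3) := by push_cast; nlinarith
      rw [abs_of_nonneg h0]
      push_cast; nlinarith
    · rw [im_center_bv_odd h]
      have h0 : (0 : ℝ) ≤ hgt * (((0 : ℤ) : ℝ) + 2 / 3) := by push_cast; nlinarith
      rw [abs_of_nonneg h0]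
      push_cast; nlinarith
  have hpR : (p : ℝ) ≤ 4 * (R : ℝ) := by exact_mod_cast hp
  have hR1 : (1 : ℝ) ≤ R := by exact_mod_cast hR
  have hp0' : (0 : ℝ) ≤ p := by exact_mod_cast hp0
  have hp2 : (0 : ℝ) ≤ p / 2 := by positivity
  calc ‖hexCenter (bv 0 p) - hexMidpoint cEdge‖
      ≤ |(hexCenter (bv 0 p) - hexMidpoint cEdge).re| +
          |(hexCenter (bv 0 p) - hexMidpoint cEdge).im| :=
        Complex.norm_le_abs_re_add_abs_im _
    _ ≤ p / 2 + 1 := by rw [hre, abs_of_nonneg hp2]; linarith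
    _ < 4 * R := by linarith

/-- Row-`-1` vertices are not in the canonical half-disc. -/
theorem bv_neg_one_not_mem_canonDisc (R : ℕ) (p : ℤ) : bv (-1) p ∉ canonDisc R := by
  rw [canonDisc, Finset.mem_filter, row_bv]
  rintro ⟨-, h⟩
  omega

/-- The boundary-row chain of the canonical walk: `i ↦ (row 0, pos L - i)`. [folklore] -/
def rowZero (L : ℕ) (i : ℕ) : HexVertex := bv 0 ((L : ℤ) - (i : ℤ))

/-- **The canonical boundary-to-boundary mass is positive** (`R ≥ 1`): the walk along row `0` from
`a_R` to `c₀` (`Negative.corridorWalk` + `pow_length_le_norm_Z`). Registered trivial sub-goal of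
this vocabulary file. -/
theorem canonical_pos : ∀ R : ℕ, 1 ≤ R → 0 < Z (canonDisc R) (aEdge R) cEdge := by
  intro R hR
  have hx : (0 : ℝ) ≤ hexCriticalFugacity := hexCriticalFugacity_pos_lt_one.1.le
  have hxpos : (0 : ℝ) < hexCriticalFugacity := hexCriticalFugacity_pos_lt_one.1
  have hcΛ : ∀ i, i ≤ 4 * R → rowZero (4 * R) i ∈ canonDisc R := by
    intro i hi
    apply bv_zero_mem_canonDisc hR
    · push_cast; omega
    · push_cast; omega
  have hinj : ∀ i j, i ≤ 4 * R → j ≤ 4 * R → rowZero (4 * R) i = rowZero (4 * R) j → i = j := by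
    intro i j _ _ h
    have := (bv_inj h).2
    omega
  have hadj : ∀ i, i < 4 * R → hexGraph.Adj (rowZero (4 * R) i) (rowZero (4 * R) (i + 1)) := by
    intro i _
    rw [rowZero, rowZero, adj_bv_iff]
    left
    refine ⟨rfl, Or.inr ?_⟩
    push_cast; ring
  have huc : hexGraph.Adj (bv (-1) ((4 * R : ℕ) : ℤ)) (rowZero (4 * R) 0) := by
    rw [rowZero, adj_bv_iff]
    right; right
    refine ⟨by push_cast; ring, by norm_num, ?_⟩
    push_cast; omega
  have hu : bv (-1) ((4 * R : ℕ) : ℤ) ∉ canonDisc R := bv_neg_one_not_mem_canonDisc R _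
  have hy : bv (-1) 0 ∉ canonDisc R := bv_neg_one_not_mem_canonDisc R _
  have haz : s(bv (-1) ((4 * R : ℕ) : ℤ), rowZero (4 * R) 0) ≠
      s(rowZero (4 * R) (4 * R), bv (-1) 0) := by
    intro h
    have hmem : bv (-1) ((4 * R : ℕ) : ℤ) ∈ s(rowZero (4 * R) (4 * R), bv (-1) 0) := by
      rw [← h]; exact Sym2.mem_mk_left _ _
    rcases Sym2.mem_iff.1 hmem with h1 | h1
    · have := (bv_inj h1).1; omega
    · have := (bv_inj h1).2; push_cast at this; omega
  let γ := corridorWalk (Λ := canonDisc R) (c := rowZero (4 * R)) (L := 4 * R)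
    hcΛ hinj hadj huc hu hy haz
  have hle := pow_length_le_norm_Z (canonDisc R) _ _ γ hx
  have hpow : (0 : ℝ) < hexCriticalFugacity ^ γ.length := pow_pos hxpos _
  have hZ : 0 < Z (canonDisc R) s(bv (-1) ((4 * R : ℕ) : ℤ), rowZero (4 * R) 0)
      s(rowZero (4 * R) (4 * R), bv (-1) 0) := lt_of_lt_of_le hpow hle
  have ha : s(bv (-1) ((4 * R : ℕ) : ℤ), rowZero (4 * R) 0) = aEdge R := by
    simp [rowZero, aEdge]
  have hc : s(rowZero (4 * R) (4 * R), bv (-1) 0) = cEdge := by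
    simp [rowZero, cEdge]
  rw [ha, hc] at hZ
  exact hZ

/-- The canonical root `a_R` is a boundary mid-edge of `H_R`. -/
theorem aEdge_mem_boundary {R : ℕ} (hR : 1 ≤ R) : aEdge R ∈ hexDomainBoundary (canonDisc R) := by
  have hadj : hexGraph.Adj (bv (-1) (4 * (R : ℤ))) (bv 0 (4 * (R : ℤ))) := by
    rw [adj_bv_iff]
    right; right
    exact ⟨rfl, by norm_num, by omega⟩
  refine ⟨(SimpleGraph.mem_edgeSet _).2 hadj, bv (-1) (4 * (R : ℤ)), bv 0 (4 * (R : ℤ)), rfl, ?_,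
    bv_neg_one_not_mem_canonDisc R _⟩
  exact bv_zero_mem_canonDisc hR (by positivity) le_rfl

/-- The canonical target `c₀` is a boundary mid-edge of `H_R`. -/
theorem cEdge_mem_boundary {R : ℕ} (hR : 1 ≤ R) : cEdge ∈ hexDomainBoundary (canonDisc R) := by
  have hadj : hexGraph.Adj (bv (-1) 0) (bv 0 0) := by
    rw [adj_bv_iff]
    right; right
    exact ⟨rfl, by norm_num, by norm_num⟩
  refine ⟨(SimpleGraph.mem_edgeSet _).2 hadj.symm, bv (-1) 0, bv 0 0, Sym2.eq_swap, ?_,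
    bv_neg_one_not_mem_canonDisc R _⟩
  exact bv_zero_mem_canonDisc hR le_rfl (by positivity)

/-- Both endpoints of `c₀` lie in the doubled half-disc: `c₀` is a bulk mid-edge of `H_R ∪ Ball_R`
(`R ≥ 1`). -/
theorem cEdge_subset_double {R : ℕ} (hR : 1 ≤ R) :
    ∀ v ∈ cEdge, v ∈ double (canonDisc R) cEdge R := by
  intro v hv
  rw [cEdge, Sym2.mem_iff] at hv
  rcases hv with rfl | rfl
  · exact subset_double _ _ _ (bv_zero_mem_canonDisc hR le_rfl (by positivity))
  · rw [double, Finset.mem_union]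
    right
    rw [mem_ball, Complex.dist_eq]
    have hre : (hexCenter (bv (-1) 0) - hexMidpoint cEdge).re = 0 := by
      rw [Complex.sub_re, re_center_bv, cMid_re]; norm_num
    have him : (hexCenter (bv (-1) 0) - hexMidpoint cEdge).im = -(hgt / 3) := by
      rw [Complex.sub_im, cMid_im, im_center_bv_odd (r := -1) (p := 0) (by norm_num)]
      push_cast; ring
    have hlt := hgt_lt
    have hgt0 := hgt_pos
    have hR1 : (1 : ℝ) ≤ R := by exact_mod_cast hR
    calc ‖hexCenter (bv (-1) 0) - hexMidpoint cEdge‖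
        ≤ |(hexCenter (bv (-1) 0) - hexMidpoint cEdge).re| +
            |(hexCenter (bv (-1) 0) - hexMidpoint cEdge).im| :=
          Complex.norm_le_abs_re_add_abs_im _
      _ = hgt / 3 := by
          rw [hre, him, abs_zero, zero_add, abs_neg,
            abs_of_nonneg (show (0 : ℝ) ≤ hgt / 3 by positivity)]
      _ < R := by linarith

end Summit.CriticalPhenomena.SAWScalingLimit.Theorems.MassRatio.Mirror
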